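import Literature.NumberTheory.Transcendental.KZLogCalculusProofs

/-!
# `NormalFormPrinciple` (stmt-KontsevichZagierPeriods-3869), line `SketchIdeator1` — registered
# sub-goal `slab_sub_pt_mem_relations`: Newton–Leibniz over the point, as an explicit certificate

Pure proof file (`--supports` the crux; siege attempt k16, variation "certificate on the finite
core"). The registered sub-goal of the split-denominator layer of the leaf `stub_boxRigidity`
(lead seat c3): for rational `α ≤ β`, an interval representation `N = [(α,β), f]` whose integrand
has the `ℚ`-rational primitive `F = P_F/Q_F` on `(α,β)` (`P_F, Q_F ∈ ℚ[X]`, `Q_F ≠ 0` on `[α,β]`),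
and any point representation `Z = [pt, F(β) − F(α)]` over `ℝ⁰`, `[N] − [Z] ∈ KZ.relations`.

The proof is a CERTIFICATE in the free abelian group `FormalRep`. With the closed-slab
representation `R = [[α,β], f]` and its restriction `E` to the two endpoints `{x₀ = α} ∪ {x₀ = β}`
(a Lebesgue-null `ℚ`-semialgebraic set),

  `[N] − [Z] = g₁ − g₂ + g₃`,  `g₁ = [R] − [Z]       ∈ newtonLeibnizRel`,
                               `g₂ = [R] − [N] − [E] ∈ domainAddRel`,
                               `g₃ = [E] − [E] − [E] ∈ domainAddRel`:

three generators of `KZ.relations` with coefficients `(+1, −1, +1)` (`certificate_mem_relations`);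
`g₁` is rule (3) over the base `ℝ⁰` with the witness `(a, b, F) = (α, β, z ↦ P_F(z₀)/Q_F(z₀))`,
`g₂` is rule (1a) for `[α,β] = (α,β) ∪ {α,β}` (the integrands of `R` and `N` agree on `(α,β)` by
hypothesis), `g₃` is rule (1a) for the null self-union `{α,β} = {α,β} ∪ {α,β}`. Only Mathlib and
`Literature.NumberTheory.Transcendental.*` are used (no other `Summits` file).

Sources: M. Kontsevich, D. Zagier, *Periods* (2001), §1.2 rules (1), (3); J. Bochnak, M. Coste,
M.-F. Roy, *Real Algebraic Geometry* (1998), §2.1–2.2. No definitions are introduced.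
-/

noncomputable section

open MeasureTheory Set
open scoped Polynomial
open Literature.NumberTheory.Transcendental Literature.NumberTheory.Transcendental.KZ
open Literature.ModelTheory.ExponentialFields (IsSemialgebraic isSemialgebraic_univ
  isSemialgebraic_setOf_eval_eq_zero isSemialgebraic_setOf_eval_nonneg)

namespace Summit.KontsevichZagierPeriods.HurwitzMicroSectors.NormalFormPrinciple.PiBox

namespace SlabK16

/-! ## The finite core: a three-term certificate of moves -/

/-- **The certificate.** For representations `R, N, E` of one dimension and `Z` of another: if
`[R] − [Z]` is a Newton–Leibniz generator and `[R] − [N] − [E]`, `[E] − [E] − [E]` are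
domain-additivity generators, then `[N] − [Z] = g₁ − g₂ + g₃ ∈ relations`.
[cite: KontsevichZagier2001, §1.2] -/
theorem certificate_mem_relations {n m : ℕ} (R N E : IntegralRep n) (Z : IntegralRep m)
    (h₁ : of R - of Z ∈ newtonLeibnizRel) (h₂ : of R - of N - of E ∈ domainAddRel)
    (h₃ : of E - of E - of E ∈ domainAddRel) : of N - of Z ∈ relations := by
  have key : of N - of Z = (of R - of Z) - (of R - of N - of E) + (of E - of E - of E) := by abel
  rw [key]
  exact relations.add_mem (relations.sub_mem (newtonLeibnizRel_subset_relations h₁)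
    (domainAddRel_subset_relations h₂)) (domainAddRel_subset_relations h₃)

/-! ## Semialgebraic and measure-theoretic atoms on `ℝ¹` -/

/-- A one-variable polynomial over `ℚ` read on the first coordinate of `ℝ¹` is the evaluation of
a polynomial in `MvPolynomial (Fin 1) ℚ`. [cite: BochnakCosteRoy1998, §2.1] -/
theorem aeval_polynomial_aeval_X (x : Fin 1 → ℝ) (A : ℚ[X]) :
    MvPolynomial.aeval x (Polynomial.aeval (MvPolynomial.X 0 : MvPolynomial (Fin 1) ℚ) A) =
      (Polynomial.aeval (x 0) A : ℝ) := by
  rw [← Polynomial.aeval_algHom_apply, MvPolynomial.aeval_X]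

/-- A rational point `{x₀ = c} ⊂ ℝ¹` is `ℚ`-semialgebraic. [folklore] -/
theorem isSemialgebraic_setOf_apply_zero_eq (c : ℚ) :
    IsSemialgebraic ℚ {x : Fin 1 → ℝ | x 0 = (c:ℝ)} := by
  have h := isSemialgebraic_setOf_eval_eq_zero (k := ℚ) (R := ℝ)
    (MvPolynomial.X 0 - MvPolynomial.C c : MvPolynomial (Fin 1) ℚ)
  have hset : {x : Fin 1 → ℝ | x 0 = (c:ℝ)} =
      {x | MvPolynomial.aeval x (MvPolynomial.X 0 - MvPolynomial.C c : MvPolynomial (Fin 1) ℚ) = 0} := by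
    ext x
    simp [sub_eq_zero]
  rw [hset]
  exact h

/-! ## The registered sub-goal -/

/-- **Newton–Leibniz over the point** (registered sub-goal `slab_sub_pt_mem_relations` of crux
stmt-KontsevichZagierPeriods-3869, by an explicit three-generator certificate). Let `α ≤ β` be
rational, `N = [(α,β), f]` an interval representation whose integrand `x ↦ f(x₀)` is
`ℚ`-semialgebraic on the closed slab, and `F = P_F/Q_F` (`P_F, Q_F ∈ ℚ[X]`, `Q_F ≠ 0` on `[α,β]`)
a primitive of `f` on `(α,β)`. Then `[N] − [Z] ∈ relations` for every point representation
`Z = [pt, F(β) − F(α)]` over `ℝ⁰`: `[N] − [Z] = ([R] − [Z]) − ([R] − [N] − [E]) + ([E] − [E] − [E])`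
with `R = [[α,β], f]`, `E = R|{α,β}` — one Newton–Leibniz generator and two domain-additivity
generators. [cite: KontsevichZagier2001, §1.2 rule (3)] -/
theorem slab_sub_pt_mem_relations {α β : ℚ} (hαβ : α ≤ β) (f : ℝ → ℝ) (PF QF : ℚ[X])
    (hQF : ∀ t ∈ Set.Icc (α:ℝ) β, (Polynomial.aeval t QF : ℝ) ≠ 0)
    (hderiv : ∀ t ∈ Set.Ioo (α:ℝ) β,
      HasDerivAt (fun u : ℝ => (Polynomial.aeval u PF : ℝ) / Polynomial.aeval u QF) (f t) t)
    (hf : IsSemialgebraicFunOn ℚ {x : Fin 1 → ℝ | x 0 ∈ Set.Icc (α:ℝ) β} (fun x => f (x 0)))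
    (N : IntegralRep 1) (hNd : N.domain = {x | x 0 ∈ Set.Ioo (α:ℝ) β})
    (hNi : EqOn N.integrand (fun x => f (x 0)) N.domain)
    (Z : IntegralRep 0) (hZd : Z.domain = univ)
    (hZi : Z.integrand = fun _ => (Polynomial.aeval (β:ℝ) PF : ℝ) / Polynomial.aeval (β:ℝ) QF -
      (Polynomial.aeval (α:ℝ) PF : ℝ) / Polynomial.aeval (α:ℝ) QF) :
    of N - of Z ∈ relations := by
  have hαβ' : (α:ℝ) ≤ β := by exact_mod_cast hαβ
  -- atoms on `ℝ¹`: the closed slab is `ℚ`-semialgebraic, a point is Lebesgue-null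
  have hCsa : IsSemialgebraic ℚ {x : Fin 1 → ℝ | x 0 ∈ Set.Icc (α:ℝ) β} := by
    have h1 := isSemialgebraic_setOf_eval_nonneg (k := ℚ) (R := ℝ)
      (MvPolynomial.X 0 - MvPolynomial.C α : MvPolynomial (Fin 1) ℚ)
    have h2 := isSemialgebraic_setOf_eval_nonneg (k := ℚ) (R := ℝ)
      (MvPolynomial.C β - MvPolynomial.X 0 : MvPolynomial (Fin 1) ℚ)
    have hset : {x : Fin 1 → ℝ | x 0 ∈ Set.Icc (α:ℝ) β} =
        {x | 0 ≤ MvPolynomial.aeval x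
            (MvPolynomial.X 0 - MvPolynomial.C α : MvPolynomial (Fin 1) ℚ)} ∩
          {x | 0 ≤ MvPolynomial.aeval x
            (MvPolynomial.C β - MvPolynomial.X 0 : MvPolynomial (Fin 1) ℚ)} := by
      ext x
      simp [sub_nonneg]
    rw [hset]
    exact h1.inter h2
  have hpt : ∀ c : ℝ, volume {x : Fin 1 → ℝ | x 0 = c} = 0 := fun c => by
    rw [volume_pi]
    exact Measure.pi_hyperplane _ _ _
  -- the three domains: the closed slab `C` (now the set in `hCsa`, `hf`), the open slab
  -- `N.domain`, the endpoints `D`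
  set C : Set (Fin 1 → ℝ) := {x | x 0 ∈ Set.Icc (α:ℝ) β} with hC
  set D : Set (Fin 1 → ℝ) := {x : Fin 1 → ℝ | x 0 = (α:ℝ)} ∪ {x | x 0 = (β:ℝ)} with hD
  have hDsa : IsSemialgebraic ℚ D :=
    (isSemialgebraic_setOf_apply_zero_eq α).union (isSemialgebraic_setOf_apply_zero_eq β)
  have hDnull : volume D = 0 := measure_union_null (hpt _) (hpt _)
  -- the primitive `z ↦ P_F(z₀)/Q_F(z₀)` is a `ℚ`-semialgebraic function on the closed slab
  have hFsa : IsSemialgebraicFunOn ℚ C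
      (fun z => (Polynomial.aeval (z 0) PF : ℝ) / Polynomial.aeval (z 0) QF) := by
    refine (isSemialgebraicFunOn_aeval_div_aeval hCsa
      (Polynomial.aeval (MvPolynomial.X 0 : MvPolynomial (Fin 1) ℚ) PF)
      (Polynomial.aeval (MvPolynomial.X 0 : MvPolynomial (Fin 1) ℚ) QF) fun x hx => ?_).congr
      fun x _ => ?_
    · rw [aeval_polynomial_aeval_X]
      exact hQF (x 0) hx
    · simp only [aeval_polynomial_aeval_X]
  have hCND : C = N.domain ∪ D := by
    rw [hC, hD, hNd]
    ext x
    simp only [mem_setOf_eq, mem_Icc, mem_Ioo, mem_union]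
    constructor
    · rintro ⟨h1, h2⟩
      rcases h1.lt_or_eq with h1 | h1
      · rcases h2.lt_or_eq with h2 | h2
        · exact Or.inl ⟨h1, h2⟩
        · exact Or.inr (Or.inr h2)
      · exact Or.inr (Or.inl h1.symm)
    · rintro (⟨h1, h2⟩ | h | h)
      · exact ⟨h1.le, h2.le⟩
      · rw [h]
        exact ⟨le_rfl, hαβ'⟩
      · rw [h]
        exact ⟨hαβ', le_rfl⟩
  have hDC : D ⊆ C := hCND ▸ subset_union_right
  -- `f` is integrable on the closed slab: it is `N.integrand` on the open slab, and `D` is null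
  have hfi : IntegrableOn (fun x : Fin 1 → ℝ => f (x 0)) C := by
    have h1 : IntegrableOn (fun x : Fin 1 → ℝ => f (x 0)) N.domain :=
      N.integrableOn.congr_fun hNi (IntegralRep.measurableSet_domain_holds N)
    rw [hCND]
    exact h1.union (IntegrableOn.of_measure_zero hDnull)
  -- the closed-slab representation `R = [[α,β], f]` and its restriction `E` to the endpoints
  obtain ⟨R, hRd, hRi⟩ : ∃ R : IntegralRep 1, R.domain = C ∧ R.integrand = fun x => f (x 0) :=
    ⟨⟨C, fun x => f (x 0), hCsa, hf, hfi⟩, rfl, rfl⟩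
  have hDR : D ⊆ R.domain := by
    rw [hRd]
    exact hDC
  obtain ⟨E, hEd, hEi⟩ : ∃ E : IntegralRep 1, E.domain = D ∧ E.integrand = R.integrand :=
    ⟨R.restrict D hDsa hDR, rfl, rfl⟩
  have hs0 : ∀ (x : Fin 0 → ℝ) (t : ℝ), (Fin.snoc x t : Fin 1 → ℝ) 0 = t := fun _ _ => rfl
  -- g₁ : ONE Newton–Leibniz generator over `ℝ⁰`, primitive `P_F(z₀)/Q_F(z₀)`
  have h₁ : of R - of Z ∈ newtonLeibnizRel := by
    refine ⟨0, R, Z, fun _ => (α:ℝ), fun _ => (β:ℝ),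
      fun z => (Polynomial.aeval (z 0) PF : ℝ) / Polynomial.aeval (z 0) QF, ?_, ?_, ?_,
      fun _ _ => hαβ', ?_, ?_, ?_, ?_, rfl⟩
    · rw [hRd]
      exact hFsa
    · rw [hZd]
      simpa using isSemialgebraicFunOn_aeval (isSemialgebraic_univ (k := ℚ) (ι := Fin 0) (R := ℝ))
        (MvPolynomial.C α)
    · rw [hZd]
      simpa using isSemialgebraicFunOn_aeval (isSemialgebraic_univ (k := ℚ) (ι := Fin 0) (R := ℝ))
        (MvPolynomial.C β)
    · rw [hRd, hZd, hC]
      ext z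
      simp only [Set.mem_setOf_eq, Set.mem_Icc, Set.mem_univ, true_and]
      rfl
    · -- continuity of the primitive on the closed fibre
      intro x _
      simp only [hs0]
      exact (Polynomial.continuous_aeval PF).continuousOn.div
        (Polynomial.continuous_aeval QF).continuousOn hQF
    · -- derivative on the open fibre
      intro x _ t ht
      rw [hRi]
      simp only [hs0]
      exact hderiv t ht
    · -- the value at the point
      intro x _
      simp only [hZi, hs0]
  -- g₂ : domain additivity `[α,β] = (α,β) ∪ {α,β}`; `R` and `N` agree on `(α,β)`
  have h₂ : of R - of N - of E ∈ domainAddRel :=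
    ⟨1, R, N, E, by rw [hEd]; exact hRd.trans hCND,
      by rw [hEd]; exact measure_mono_null inter_subset_right hDnull,
      fun x hx => by rw [hRi]; exact (hNi hx).symm,
      fun x _ => by rw [hEi], rfl⟩
  -- g₃ : the null self-union `{α,β} = {α,β} ∪ {α,β}`
  have h₃ : of E - of E - of E ∈ domainAddRel :=
    ⟨1, E, E, E, (union_self _).symm, by rw [inter_self, hEd]; exact hDnull,
      fun _ _ => rfl, fun _ _ => rfl, rfl⟩
  exact certificate_mem_relations R N E Z h₁ h₂ h₃

end SlabK16

end Summit.KontsevichZagierPeriods.HurwitzMicroSectors.NormalFormPrinciple.PiBox
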